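import Mathlib
import Literature.Analysis.FluidPDE.GaussianVortexPlanar
import Literature.Analysis.FluidPDE.GaussianVortexPlanarProofs
import Summits.AnomalousDissipation.AnomalousDissipation.Theorems.MarginalStabilityChainStretchedVortexRowsStubCoreLEnergyGapTools
import Summits.AnomalousDissipation.AnomalousDissipation.Theorems.MarginalStabilityChainStretchedVortexRowsStubCoreLEnergyGapYControl
import HarnessLib

/-!
# Helper `coreL_energy_gap` toward stub `stub_coreInverse` of the line `braid-closed-large-circulation-gluing`
# (crux stmt-AnomalousDissipation-3009, `MarginalStabilityChain.StretchedVortexRows`)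

(I1) + (I2) + `Y`-control for the Gallay–Wayne core operator `L = strainedVorticityOperator 0 = Δ + ½ξ·∇ + 1` in
`X = L²(G⁻¹dξ)`, `G = gaussVortexProfile`, in ground-state variables `w = G u` (`u ∈ C²(ℝ²)`, `u, Du, D²u` bounded,
`∫ G u = ∫ w = 0`):

* `⟨Lw, w⟩_X = ∫ G⁻¹(Lw) w = −∫ G‖Du‖²` — landed helper `coreL_energy_identity` (conjugation `G⁻¹L(Gu) = Δu − ½Du[ξ]`
  plus the tree's Ornstein–Uhlenbeck Dirichlet form), module `…StubCoreLEnergyGapTools`;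
* `½ ∫ G u² ≤ ∫ G‖Du‖²` — landed helper `coreL_gap` (Gaussian Poincaré inequality, spectral gap `½`,
  Gallay–Wayne 2005, Prop. 4.1 / App. A), same module;
* `‖w‖²_Y = gwSobolevNormSq (G u) ≤ 16 ((∫ G‖Du‖²) + ∫ G u²)` — landed helper `coreL_Y_control`
  (`∇w = G(∇u − uξ/2)` and the Gaussian second-moment bound `∫|ξ|²u²G ≤ 16∫G‖Du‖² + 8∫Gu²`), module
  `…StubCoreLEnergyGapYControl`.

This file is the assembly. (The first registered version of the signature lacked the parentheses around the first
integral of the `Y`-bound and parsed as a junk integral; the present statement is the re-registered, corrected one.)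

References: Th. Gallay, C. E. Wayne, Comm. Math. Phys. 255 (2005), Prop. 4.1, App. A; Th. Gallay, C. E. Wayne,
J. Math. Fluid Mech. 9 (2007), (1.9), §2.
-/

set_option linter.dupNamespace false

noncomputable section

open scoped RealInnerProductSpace Topology Laplacian
open MeasureTheory WithLp Function

namespace Summit.AnomalousDissipation.AnomalousDissipation.Theorems.MarginalStabilityChainStretchedVortexRows

open Literature.Analysis.FluidPDE

/-- **H6 (I1+I2+Y): Dirichlet energy and spectral gap of `L` in `L²(G⁻¹)` at `λ = 0`, ground-state form, PLUS the
`Y`-norm control** (registered helper toward `stub_coreInverse`): for `u ∈ C²(ℝ²)` with `u, Du, D²u` bounded and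
`∫ G u = 0`, `∫ G⁻¹ L(Gu)·(Gu) = −∫ G‖Du‖²`, `½∫ G u² ≤ ∫ G‖Du‖²`, and `‖G u‖²_Y ≤ 16((∫ G‖Du‖²) + ∫ G u²)`. [folklore] -/
theorem coreL_energy_gap :
    ∀ u : EuclideanSpace ℝ (Fin 2) → ℝ, ContDiff ℝ 2 u →
      (∃ M : ℝ, ∀ ξ, |u ξ| ≤ M ∧ ‖fderiv ℝ u ξ‖ ≤ M ∧ ‖fderiv ℝ (fderiv ℝ u) ξ‖ ≤ M) →
      (∫ ξ, gaussVortexProfile ξ * u ξ = 0) →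
      (∫ ξ, (gaussVortexProfile ξ)⁻¹ *
          strainedVorticityOperator 0 (fun η => gaussVortexProfile η * u η) ξ * (gaussVortexProfile ξ * u ξ) =
        -∫ ξ, gaussVortexProfile ξ * ‖fderiv ℝ u ξ‖ ^ 2) ∧
      (1 / 2 * ∫ ξ, gaussVortexProfile ξ * u ξ ^ 2 ≤ ∫ ξ, gaussVortexProfile ξ * ‖fderiv ℝ u ξ‖ ^ 2) ∧
      gwSobolevNormSq (fun η => gaussVortexProfile η * u η) ≤
        16 * ((∫ ξ, gaussVortexProfile ξ * ‖fderiv ℝ u ξ‖ ^ 2) + ∫ ξ, gaussVortexProfile ξ * u ξ ^ 2) := by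
  intro u hu hM hmean
  obtain ⟨M, hM⟩ := hM
  have hM' : ∃ M : ℝ, ∀ ξ, |u ξ| ≤ M ∧ ‖fderiv ℝ u ξ‖ ≤ M := ⟨M, fun ξ => ⟨(hM ξ).1, (hM ξ).2.1⟩⟩
  exact ⟨coreL_energy_identity u hu ⟨M, hM⟩, coreL_gap u (hu.of_le one_le_two) hM' hmean,
    coreL_Y_control u (hu.of_le one_le_two) hM'⟩

end Summit.AnomalousDissipation.AnomalousDissipation.Theorems.MarginalStabilityChainStretchedVortexRows

end
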